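import Mathlib
import HarnessLib
import Summits.AtomisticToContinuum.FouriersLaw.Theorems.JunctionLocalityNonBallisticLightConePropagation
import Summits.AtomisticToContinuum.FouriersLaw.Theorems.JunctionLocalityConductanceLowerBoundStubShortTimeDipoleFloorAux6

/-!
# Short-time dipole floor, helper 10: one-scalar domination of the local factors (pathwise algebra)

Helper (`--supports stmt-AtomisticToContinuum-11749`) for stub `stub_shortTimeDipoleFloor` (S) of line
`kick-dipole-no-collapse`, crux `JunctionLocality.ConductanceLowerBound`.  Deterministic inequalities only.

Every local factor met by the annealed light cone at a bond `(k, k+1)` of the pinned chain — the force `V'(r_k)`, its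
Lipschitz constant, the momenta, the contact power `a₀ = p_0 ∂_{q_0}H` — is dominated by a power of ONE nonnegative scalar
`E_k(z) = 1 + q_k² + q_{k+1}² + p_k² + p_{k+1}²` (`bondScalar`-type expressions written out), whose Gibbs moments are local and
`N`-uniform:

* `abs_bondCurrent_sub_le_scalar` — `|j_k(z') − j_k(z)| ≤ (7 + 15β) E_k(z)² E_k(z')² (u_k + u_{k+1})`,
  `u_m = |q'_m − q_m| + |p'_m − p_m|`;
* `abs_contactPower_le_scalar` — `|p_0 ∂_{q_0}H| ≤ (ω₂ + 2 lam + 2 + 5β) E_0(x)³` (`N ≥ 2`);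
* `helper_kdOneScalarDomination` — the registered closed form of the two bounds.
-/

noncomputable section

open MeasureTheory Set Filter Topology Finset

namespace Summit.AtomisticToContinuum.FouriersLaw.Cruxes.ConductanceLowerBound.KickDipoleNoCollapse

open Literature.MathematicalPhysics.KineticTheory.HeatConduction
open Summit.AtomisticToContinuum.FouriersLaw.Theorems.NonBallistic

variable {N : ℕ} {ω₂ lam β γ : ℝ}

/-! ### Elementary scalar bounds -/

/-- `|x| ≤ 1 + x²`. -/
theorem abs_le_one_add_sq (x : ℝ) : |x| ≤ 1 + x ^ 2 := by
  rcases le_total 0 x with h | h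
  · rw [abs_of_nonneg h]; nlinarith [sq_nonneg (x - 1)]
  · rw [abs_of_nonpos h]; nlinarith [sq_nonneg (x + 1)]

/-- `|x|³ ≤ 1 + x⁴`. -/
theorem abs_pow_three_le (x : ℝ) : |x| ^ 3 ≤ 1 + x ^ 4 := by
  have h4 : x ^ 4 = |x| ^ 4 := by rw [← abs_pow]; exact (abs_of_nonneg (by positivity)).symm
  rw [h4]
  have ha := abs_nonneg x
  rcases le_total |x| 1 with h | h
  · have : |x| ^ 3 ≤ 1 := pow_le_one₀ ha h
    linarith [pow_nonneg ha 4]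
  · nlinarith [pow_le_pow_left₀ zero_le_one h 3, pow_nonneg ha 3]

/-- The two positions, the two momenta and the bond stretch of a bond are dominated by the bond scalar
`E = 1 + q_k² + q_l² + p_k² + p_l²`: `|q_k|, |q_l|, |p_k|, |p_l| ≤ E`, `(q_l − q_k)² ≤ 2E`, `|q_l − q_k|³ ≤ 5E²`, `1 ≤ E`. -/
theorem bondScalar_bounds (qk ql pk pl : ℝ) :
    1 ≤ 1 + qk ^ 2 + ql ^ 2 + pk ^ 2 + pl ^ 2 ∧
    |qk| ≤ 1 + qk ^ 2 + ql ^ 2 + pk ^ 2 + pl ^ 2 ∧ |ql| ≤ 1 + qk ^ 2 + ql ^ 2 + pk ^ 2 + pl ^ 2 ∧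
    |pk| ≤ 1 + qk ^ 2 + ql ^ 2 + pk ^ 2 + pl ^ 2 ∧ |pl| ≤ 1 + qk ^ 2 + ql ^ 2 + pk ^ 2 + pl ^ 2 ∧
    (ql - qk) ^ 2 ≤ 2 * (1 + qk ^ 2 + ql ^ 2 + pk ^ 2 + pl ^ 2) ∧
    |ql - qk| ^ 3 ≤ 5 * (1 + qk ^ 2 + ql ^ 2 + pk ^ 2 + pl ^ 2) ^ 2 := by
  set E := 1 + qk ^ 2 + ql ^ 2 + pk ^ 2 + pl ^ 2 with hE
  have hE1 : 1 ≤ E := by rw [hE]; nlinarith [sq_nonneg qk, sq_nonneg ql, sq_nonneg pk, sq_nonneg pl]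
  have h1 := abs_le_one_add_sq qk
  have h2 := abs_le_one_add_sq ql
  have h3 := abs_le_one_add_sq pk
  have h4 := abs_le_one_add_sq pl
  have hr2 : (ql - qk) ^ 2 ≤ 2 * E := by rw [hE]; nlinarith [sq_nonneg (ql + qk), sq_nonneg pk, sq_nonneg pl]
  have hr4 : (ql - qk) ^ 4 ≤ 4 * E ^ 2 := by
    have : (ql - qk) ^ 4 = ((ql - qk) ^ 2) ^ 2 := by ring
    rw [this]; nlinarith [sq_nonneg (ql - qk)]
  refine ⟨hE1, ?_, ?_, ?_, ?_, hr2, ?_⟩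
  · rw [hE]; nlinarith [sq_nonneg ql, sq_nonneg pk, sq_nonneg pl]
  · rw [hE]; nlinarith [sq_nonneg qk, sq_nonneg pk, sq_nonneg pl]
  · rw [hE]; nlinarith [sq_nonneg qk, sq_nonneg ql, sq_nonneg pl]
  · rw [hE]; nlinarith [sq_nonneg qk, sq_nonneg ql, sq_nonneg pk]
  · have := abs_pow_three_le (ql - qk)
    nlinarith

/-- `|V'(r)| = |r + βr³| ≤ (2 + 5β) E²` for the stretch `r = q_l − q_k` of a bond with scalar `E` (`β ≥ 0`). -/
theorem abs_derivV_le_scalar (hβ : 0 ≤ β) (qk ql pk pl : ℝ) :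
    |(ql - qk) + β * (ql - qk) ^ 3| ≤ (2 + 5 * β) * (1 + qk ^ 2 + ql ^ 2 + pk ^ 2 + pl ^ 2) ^ 2 := by
  obtain ⟨hE1, hqk, hql, -, -, -, hr3⟩ := bondScalar_bounds qk ql pk pl
  set E := 1 + qk ^ 2 + ql ^ 2 + pk ^ 2 + pl ^ 2 with hE
  have hr1 : |ql - qk| ≤ 2 * E := by
    calc |ql - qk| ≤ |ql| + |qk| := abs_sub _ _
      _ ≤ E + E := add_le_add hql hqk
      _ = 2 * E := by ring
  have hEE : E ≤ E ^ 2 := by nlinarith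
  calc |(ql - qk) + β * (ql - qk) ^ 3| ≤ |ql - qk| + |β * (ql - qk) ^ 3| := abs_add_le _ _
    _ = |ql - qk| + β * |ql - qk| ^ 3 := by rw [abs_mul, abs_of_nonneg hβ, abs_pow]
    _ ≤ 2 * E + β * (5 * E ^ 2) := by gcongr
    _ ≤ (2 + 5 * β) * E ^ 2 := by nlinarith

/-- Closed form of the bond current on a genuine bond `(k, k+1)`. -/
theorem bondCurrent_eq_of_lt' (P : OscillatorChain) {k : Fin N} (hk : k.val + 1 < N) (x : PhaseSpace N) :
    P.bondCurrent N k x = -((x.2 k + x.2 ⟨k.val + 1, hk⟩) / 2 * deriv P.V (x.1 ⟨k.val + 1, hk⟩ - x.1 k)) := by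
  unfold OscillatorChain.bondCurrent
  rw [Finset.sum_eq_single ⟨k.val + 1, hk⟩]
  · simp
  · intro j _ hj
    rw [if_neg]
    intro h
    exact hj (Fin.ext h)
  · intro h; exact absurd (Finset.mem_univ _) h

/-- **One-scalar bound for the bond-current difference.**  On a genuine bond `(k, k+1)`, for two states `z, z'` with bond
scalars `E = 1 + q_k² + q_{k+1}² + p_k² + p_{k+1}²`, `E'` (same for `z'`):
`|j_k(z') − j_k(z)| ≤ (7 + 15β) E² E'² (|δq_k| + |δp_k| + |δq_{k+1}| + |δp_{k+1}|)`. -/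
theorem abs_bondCurrent_sub_le_scalar (hβ : 0 ≤ β) (k : Fin N) (hk : k.val + 1 < N) (z z' : PhaseSpace N) :
    |(pinnedChain ω₂ lam β γ).bondCurrent N k z' - (pinnedChain ω₂ lam β γ).bondCurrent N k z| ≤
      (7 + 15 * β) * (1 + z.1 k ^ 2 + z.1 ⟨k.val + 1, hk⟩ ^ 2 + z.2 k ^ 2 + z.2 ⟨k.val + 1, hk⟩ ^ 2) ^ 2 *
        (1 + z'.1 k ^ 2 + z'.1 ⟨k.val + 1, hk⟩ ^ 2 + z'.2 k ^ 2 + z'.2 ⟨k.val + 1, hk⟩ ^ 2) ^ 2 *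
        (|z'.1 k - z.1 k| + |z'.2 k - z.2 k| + |z'.1 ⟨k.val + 1, hk⟩ - z.1 ⟨k.val + 1, hk⟩| +
          |z'.2 ⟨k.val + 1, hk⟩ - z.2 ⟨k.val + 1, hk⟩|) := by
  set k1 : Fin N := ⟨k.val + 1, hk⟩ with hk1
  obtain ⟨hE1, -, -, hpk, hpl, hr2, -⟩ := bondScalar_bounds (z.1 k) (z.1 k1) (z.2 k) (z.2 k1)
  obtain ⟨hE1', -, -, -, -, hr2', -⟩ := bondScalar_bounds (z'.1 k) (z'.1 k1) (z'.2 k) (z'.2 k1)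
  set E := 1 + z.1 k ^ 2 + z.1 k1 ^ 2 + z.2 k ^ 2 + z.2 k1 ^ 2 with hE
  set E' := 1 + z'.1 k ^ 2 + z'.1 k1 ^ 2 + z'.2 k ^ 2 + z'.2 k1 ^ 2 with hE'
  rw [bondCurrent_eq_of_lt' (pinnedChain ω₂ lam β γ) hk z', bondCurrent_eq_of_lt' (pinnedChain ω₂ lam β γ) hk z,
    pinnedChain_deriv_V, pinnedChain_deriv_V]
  set r := z.1 k1 - z.1 k with hr
  set r' := z'.1 k1 - z'.1 k with hr'
  set a := z.2 k + z.2 k1 with ha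
  set a' := z'.2 k + z'.2 k1 with ha'
  -- the `V′` bound needs the unfolded scalar; afterwards the scalars are made opaque
  have hV' : |r' + β * r' ^ 3| ≤ (2 + 5 * β) * E' ^ 2 := abs_derivV_le_scalar hβ (z'.1 k) (z'.1 k1) (z'.2 k) (z'.2 k1)
  set D := |z'.1 k - z.1 k| + |z'.2 k - z.2 k| + |z'.1 k1 - z.1 k1| + |z'.2 k1 - z.2 k1| with hD
  have hD0 : 0 ≤ D := by positivity
  have hdr : |r' - r| ≤ D := by
    have : r' - r = (z'.1 k1 - z.1 k1) - (z'.1 k - z.1 k) := by rw [hr, hr']; ring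
    rw [this]
    calc |(z'.1 k1 - z.1 k1) - (z'.1 k - z.1 k)| ≤ |z'.1 k1 - z.1 k1| + |z'.1 k - z.1 k| := abs_sub _ _
      _ ≤ D := by rw [hD]; linarith [abs_nonneg (z'.2 k - z.2 k), abs_nonneg (z'.2 k1 - z.2 k1)]
  have hda : |a' - a| ≤ D := by
    have : a' - a = (z'.2 k - z.2 k) + (z'.2 k1 - z.2 k1) := by rw [ha, ha']; ring
    rw [this]
    calc |(z'.2 k - z.2 k) + (z'.2 k1 - z.2 k1)| ≤ |z'.2 k - z.2 k| + |z'.2 k1 - z.2 k1| := abs_add_le _ _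
      _ ≤ D := by rw [hD]; linarith [abs_nonneg (z'.1 k - z.1 k), abs_nonneg (z'.1 k1 - z.1 k1)]
  have haa : |a| ≤ 2 * E := by
    calc |a| ≤ |z.2 k| + |z.2 k1| := abs_add_le _ _
      _ ≤ E + E := add_le_add hpk hpl
      _ = 2 * E := by ring
  clear_value E E'
  -- the Lipschitz bound of `V′`
  have hdV : |(r' + β * r' ^ 3) - (r + β * r ^ 3)| ≤ (1 + 2 * β) * (5 * (E * E')) * D := by
    have h := abs_cubic_sub_cubic_le_local (c₁ := 1) (c₃ := β) (a := r') (b := r) zero_le_one hβ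
    rw [one_mul, one_mul] at h
    refine h.trans ?_
    have hrr : 1 + r' ^ 2 + r ^ 2 ≤ 5 * (E * E') := by nlinarith [mul_le_mul hE1 hE1' zero_le_one (by linarith)]
    exact mul_le_mul (mul_le_mul_of_nonneg_left hrr (by positivity)) hdr (abs_nonneg _) (by positivity)
  -- algebra: j' - j = -½ [ (a' - a) V′(r') + a (V′(r') - V′(r)) ]
  have hsplit : -(a' / 2 * (r' + β * r' ^ 3)) - -(a / 2 * (r + β * r ^ 3)) =
      -(1 / 2) * ((a' - a) * (r' + β * r' ^ 3) + a * ((r' + β * r' ^ 3) - (r + β * r ^ 3))) := by ring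
  rw [hsplit, abs_mul, show |-(1 / 2 : ℝ)| = 1 / 2 by norm_num]
  have hT1 : |(a' - a) * (r' + β * r' ^ 3)| ≤ D * ((2 + 5 * β) * E' ^ 2) := by
    rw [abs_mul]; exact mul_le_mul hda hV' (abs_nonneg _) hD0
  have hT2 : |a * ((r' + β * r' ^ 3) - (r + β * r ^ 3))| ≤ (2 * E) * ((1 + 2 * β) * (5 * (E * E')) * D) := by
    rw [abs_mul]; exact mul_le_mul haa hdV (abs_nonneg _) (by positivity)
  have hsum := abs_add_le ((a' - a) * (r' + β * r' ^ 3)) (a * ((r' + β * r' ^ 3) - (r + β * r ^ 3)))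
  have hE0 : 0 ≤ E := zero_le_one.trans hE1
  have hE0' : 0 ≤ E' := zero_le_one.trans hE1'
  set X := E ^ 2 * E' ^ 2 * D with hX
  have hX0 : 0 ≤ X := by positivity
  have hY1 : E' ^ 2 * D ≤ X := by
    rw [hX]
    refine mul_le_mul_of_nonneg_right ?_ hD0
    exact le_mul_of_one_le_left (sq_nonneg E') (one_le_pow₀ hE1)
  have hY2 : E ^ 2 * E' * D ≤ X := by
    rw [hX]
    refine mul_le_mul_of_nonneg_right (mul_le_mul_of_nonneg_left ?_ (sq_nonneg E)) hD0
    exact le_self_pow₀ hE1' two_ne_zero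
  clear_value X D r r' a a'
  have hβ1 : 0 ≤ 2 + 5 * β := by positivity
  have hβ2 : 0 ≤ 10 * (1 + 2 * β) := by positivity
  have h1 := mul_le_mul_of_nonneg_left hY1 hβ1
  have h2 := mul_le_mul_of_nonneg_left hY2 hβ2
  have e1 : D * ((2 + 5 * β) * E' ^ 2) = (2 + 5 * β) * (E' ^ 2 * D) := by ring
  have e2 : (2 * E) * ((1 + 2 * β) * (5 * (E * E')) * D) = 10 * (1 + 2 * β) * (E ^ 2 * E' * D) := by ring
  rw [e1] at hT1
  rw [e2] at hT2
  have hfin : (2 + 5 * β) * X + 10 * (1 + 2 * β) * X ≤ 2 * ((7 + 15 * β) * X) := by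
    have h3 : 0 ≤ β * X := mul_nonneg hβ hX0
    linarith only [h3, hX0]
  calc 1 / 2 * |(a' - a) * (r' + β * r' ^ 3) + a * ((r' + β * r' ^ 3) - (r + β * r ^ 3))|
      ≤ 1 / 2 * ((2 + 5 * β) * X + 10 * (1 + 2 * β) * X) := by
        refine mul_le_mul_of_nonneg_left ?_ (by norm_num)
        exact hsum.trans (add_le_add (hT1.trans h1) (hT2.trans h2))
    _ ≤ (7 + 15 * β) * X := by linarith only [hfin]
    _ = (7 + 15 * β) * E ^ 2 * E' ^ 2 * D := by rw [hX]; ring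

/-- `|U'(q)| = |ω₂ q + lam q³| ≤ (ω₂ + 2 lam) E²` whenever `|q| ≤ E`, `q² ≤ E`, `1 ≤ E` (`ω₂, lam ≥ 0`). -/
theorem abs_derivU_le_scalar (hω : 0 ≤ ω₂) (hl : 0 ≤ lam) {q E : ℝ} (hE1 : 1 ≤ E) (hq : |q| ≤ E) (hq2 : q ^ 2 ≤ E) :
    |ω₂ * q + lam * q ^ 3| ≤ (ω₂ + 2 * lam) * E ^ 2 := by
  have hE0 : 0 ≤ E := zero_le_one.trans hE1
  have hq3 : |q| ^ 3 ≤ 2 * E ^ 2 := by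
    have h := abs_pow_three_le q
    have hq4 : q ^ 4 ≤ E ^ 2 := by
      have : q ^ 4 = (q ^ 2) ^ 2 := by ring
      rw [this]; exact pow_le_pow_left₀ (sq_nonneg q) hq2 2
    nlinarith [one_le_pow₀ (n := 2) hE1]
  calc |ω₂ * q + lam * q ^ 3| ≤ |ω₂ * q| + |lam * q ^ 3| := abs_add_le _ _
    _ = ω₂ * |q| + lam * |q| ^ 3 := by rw [abs_mul, abs_mul, abs_of_nonneg hω, abs_of_nonneg hl, abs_pow]
    _ ≤ ω₂ * E + lam * (2 * E ^ 2) := by gcongr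
    _ ≤ (ω₂ + 2 * lam) * E ^ 2 := by nlinarith [mul_nonneg hω (sub_nonneg.2 (le_self_pow₀ hE1 two_ne_zero))]

/-- **One-scalar bound for the contact power** (`N ≥ 2`): `|p_0 ∂_{q_0}H| ≤ (ω₂ + 2 lam + 2 + 5β) E_0³`,
`E_0 = 1 + q_0² + q_1² + p_0² + p_1²`. -/
theorem abs_contactPower_le_scalar (hω : 0 ≤ ω₂) (hl : 0 ≤ lam) (hβ : 0 ≤ β) (hN : 0 < N) (hN2 : 2 ≤ N)
    (x : PhaseSpace N) :
    |x.2 ⟨0, hN⟩ * partialQ ⟨0, hN⟩ ((pinnedChain ω₂ lam β γ).hamiltonian N) x| ≤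
      (ω₂ + 2 * lam + 2 + 5 * β) * (1 + x.1 ⟨0, hN⟩ ^ 2 + x.1 ⟨1, hN2⟩ ^ 2 + x.2 ⟨0, hN⟩ ^ 2 + x.2 ⟨1, hN2⟩ ^ 2) ^ 3 := by
  set P := pinnedChain ω₂ lam β γ with hP
  set i0 : Fin N := ⟨0, hN⟩ with hi0
  set i1 : Fin N := ⟨1, hN2⟩ with hi1
  obtain ⟨hE1, hq0, -, hp0, -, hr2, -⟩ := bondScalar_bounds (x.1 i0) (x.1 i1) (x.2 i0) (x.2 i1)
  have hV := abs_derivV_le_scalar hβ (x.1 i0) (x.1 i1) (x.2 i0) (x.2 i1)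
  have hq02 : x.1 i0 ^ 2 ≤ 1 + x.1 i0 ^ 2 + x.1 i1 ^ 2 + x.2 i0 ^ 2 + x.2 i1 ^ 2 := by
    nlinarith [sq_nonneg (x.1 i1), sq_nonneg (x.2 i0), sq_nonneg (x.2 i1)]
  have hU := abs_derivU_le_scalar hω hl hE1 hq0 hq02
  set E := 1 + x.1 i0 ^ 2 + x.1 i1 ^ 2 + x.2 i0 ^ 2 + x.2 i1 ^ 2 with hE
  have hdP : partialQ i0 (P.hamiltonian N) x = (ω₂ * x.1 i0 + lam * x.1 i0 ^ 3) - ((x.1 i1 - x.1 i0) + β * (x.1 i1 - x.1 i0) ^ 3) := by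
    rw [P.partialQ_hamiltonian_eq_dPotential ((pinnedChain_contDiff_U ω₂ lam β γ (n := 1)).differentiable one_ne_zero)
      ((pinnedChain_contDiff_V ω₂ lam β γ (n := 1)).differentiable one_ne_zero), OscillatorChain.dPotential_eq_closed]
    simp only [hP, pinnedChain_deriv_U, pinnedChain_deriv_V]
    rw [dif_neg (by simp [hi0]), dif_pos (by show 0 + 1 < N; omega)]
    have e : (⟨(i0 : ℕ) + 1, by show (0:ℕ) + 1 < N; omega⟩ : Fin N) = i1 := Fin.ext (by simp [hi0, hi1])
    rw [e]; ring
  clear_value E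
  rw [abs_mul, hdP]
  have hE0 : 0 ≤ E := zero_le_one.trans hE1
  calc |x.2 i0| * |(ω₂ * x.1 i0 + lam * x.1 i0 ^ 3) - ((x.1 i1 - x.1 i0) + β * (x.1 i1 - x.1 i0) ^ 3)|
      ≤ E * ((ω₂ + 2 * lam) * E ^ 2 + (2 + 5 * β) * E ^ 2) :=
        mul_le_mul hp0 ((abs_sub _ _).trans (add_le_add hU hV)) (abs_nonneg _) hE0
    _ = (ω₂ + 2 * lam + 2 + 5 * β) * E ^ 3 := by ring

/-- **Registered helper `helper_kdOneScalarDomination` (stub S, line `kick-dipole-no-collapse`): ONE-SCALAR DOMINATION OF THE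
LOCAL FACTORS** (closed forms of `abs_bondCurrent_sub_le_scalar` and `abs_contactPower_le_scalar`): on a genuine bond `(k, k+1)`
the bond-current difference of two states is at most `(7 + 15β) E_k² E_k'²` times the four coordinate deviations, and the
contact power satisfies `|p_0 ∂_{q_0}H| ≤ (ω₂ + 2 lam + 2 + 5β) E_0³` (`N ≥ 2`), with the bond scalars
`E_k = 1 + q_k² + q_{k+1}² + p_k² + p_{k+1}²`. -/
theorem helper_kdOneScalarDomination : ∀ ω₂ lam β γ : ℝ, 0 ≤ ω₂ → 0 ≤ lam → 0 ≤ β → ∀ (N : ℕ) (hN : 2 ≤ N), (∀ (k : Fin N) (hk : k.val + 1 < N) (z z' : PhaseSpace N), |(pinnedChain ω₂ lam β γ).bondCurrent N k z' - (pinnedChain ω₂ lam β γ).bondCurrent N k z| ≤ (7 + 15 * β) * (1 + z.1 k ^ 2 + z.1 ⟨k.val + 1, hk⟩ ^ 2 + z.2 k ^ 2 + z.2 ⟨k.val + 1, hk⟩ ^ 2) ^ 2 * (1 + z'.1 k ^ 2 + z'.1 ⟨k.val + 1, hk⟩ ^ 2 + z'.2 k ^ 2 + z'.2 ⟨k.val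 + 1, hk⟩ ^ 2) ^ 2 * (|z'.1 k - z.1 k| + |z'.2 k - z.2 k| + |z'.1 ⟨k.val + 1, hk⟩ - z.1 ⟨k.val + 1, hk⟩| + |z'.2 ⟨k.val + 1, hk⟩ - z.2 ⟨k.val + 1, hk⟩|)) ∧ ∀ x : PhaseSpace N, |x.2 ⟨0, by omega⟩ * partialQ ⟨0, by omega⟩ ((pinnedChain ω₂ lam β γ).hamiltonian N) x| ≤ (ω₂ + 2 * lam + 2 + 5 * β) * (1 + x.1 ⟨0, by omega⟩ ^ 2 + x.1 ⟨1, hN⟩ ^ 2 + x.2 ⟨0, by omega⟩ ^ 2 + x.2 ⟨1, hN⟩ ^ 2) ^ 3 := by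
  intro ω₂ lam β γ hω hl hβ N hN2
  exact ⟨fun k hk z z' => abs_bondCurrent_sub_le_scalar hβ k hk z z',
    fun x => abs_contactPower_le_scalar hω hl hβ (by omega) hN2 x⟩

end Summit.AtomisticToContinuum.FouriersLaw.Cruxes.ConductanceLowerBound.KickDipoleNoCollapse

end
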